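import Summits.BirchSwinnertonDyer.BirchSwinnertonDyer.Theorems.KolyvaginRoadThreeMethod2InductionOfLevelSystems
import Summits.BirchSwinnertonDyer.BirchSwinnertonDyer.Theorems.KolyvaginRoadThreeMethod2Membership
import Summits.BirchSwinnertonDyer.BirchSwinnertonDyer.Theorems.KolyvaginRoadThreeMethod2Step
import Literature.NumberTheory.GaloisRepresentations.LocalGlobalCohomology
import HarnessLib

/-!
# KOLY method line, crux stmt-BirchSwinnertonDyer-19574 `ZhangSharpFrameAtThreeHL`: the DICTIONARY LAYER of the
# proposed stub S2-ENGINE — from a `LevelKolyvaginSystem` (model currency) to the engine's level-DEPENDENT binders,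
# over the places of `K` (cell `bsd-stepL`, seat `bsd-stepL-zhang3-p1` g8; `--supports 19574`, helper; v3 re-line,
# memo `HOME/zhang3/S2-RELINE-19574.md` §2 item 2)

HONEST FRAMING. One theorem; 0 definitions, 0 named facts, 0 `sorry`; CONDITIONAL on every binder; closes nothing (T7).
PARTITION: O2@3 (B10) × A1 × crux 19574 × stub S2 (proposed S2-ENGINE) — types-the-object-of.

WHAT. `Method2.inductionOfLevelSystems_of_engineInputs` (p498115) proves S2-ENGINE modulo engine-currency inputs over
an ARBITRARY place-indexed apparatus, several of which still speak about the level system's classes and the canonical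
spaces (the dictionaries `hSel` ∕ `hSelRel` ∕ `hB`, the readings `hcE` ∕ `hcL` ∕ `hcT` ∕ `hfs`, `hLF`, `hpl`). Here
the places are FIXED to `NumberField.Place K` (infinite ⊕ finite), the local conditions are NAMED per place (`Kum
v` = E's Kummer condition, `Ord v` = ordinary, `Tr ℓ` = transverse at the place of the Kolyvagin prime `ℓ`) through
five PER-PLACE DICTIONARIES with the tree's global Gross-currency (`selmerLocalKer` ∕ `ordinaryLocalKer` ∕
`torsionLocalKer` ∕ `Method2.transverseLocalKer`), the level structure `L n` is pinned by three equations (Kummer at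
infinite places and away from `n`, ordinary on `n`), and ALL the system-dependent binders are DISCHARGED from the
fields of the `LevelKolyvaginSystem` (`sign`, `selmer_off`, `selmer_inf`, `ordinary_on`, `transverse_on`, `relation`,
`realisation`, `transport`, `baseCase`) and the membership dictionaries `mem_selQ_iff` ∕ `mem_selRelQ_iff` (p498218).
What remains as hypotheses is GENUINELY level-system-free: the per-place dictionaries (for the tree's
`galoisCohomology.localization`: `ker loc_v = torsionLocalKer_v` by the two-model comparison, the local conditions as
images), (REC), isotropy of `Kum` ∕ `Ord` ∕ `Tr`, (Perf) ∕ (Line) at Kolyvagin primes, (Cheb) ×2, (Supply) — the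
S2-ENGINE work package proper.

References: [cite: WZhang2014, §8.1, Lemma 8.4, §9 proof of Thm. 9.1] [cite: McCallumLMS1991, Prop. 3.1, Lemma 5.3]
[cite: GrossLMS1991, §3 (3.1)–(3.3)].
-/

noncomputable section

open scoped Classical

namespace Summit.BirchSwinnertonDyer.Rank1Residual.X11b.Three.Koly.Method2

open WeierstrassCurve NumberField IsDedekindDomain
  Literature.NumberTheory.EllipticCurves Literature.NumberTheory.EllipticCurves.ModularForms
  Literature.NumberTheory.GaloisRepresentations Module

variable (W : WeierstrassCurve ℚ) (K : Type) [Field K] [NumberField K] [W.IsGloballyMinimal]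

/-- A Kolyvagin prime at `p = 3` and a unipotent-admissible prime are distinct (`3 ∣ ℓ + 1`, `q ≡ 1 (mod 3)`), hence
coprime. [cite: WZhang2014, Notations (xii), (xiv)] -/
theorem coprime_of_uAdmissible_of_kolyvagin {q ℓ : ℕ} (hq : IsUAdmissiblePrime W K q)
    (hℓ : Zhang2014.IsKolyvaginPrime (W.conductorNorm ℤ) W K 3 ℓ) : Nat.Coprime q ℓ := by
  refine (Nat.coprime_primes hq.1 hℓ.1).mpr fun h ↦ ?_
  have h3 : 3 ∣ ℓ + 1 := (Zhang2014.IsKolyvaginPrime.dvd (p := 3) hℓ).1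
  have hq1 : q % 3 = 1 := hq.2.2.2.2.2.1
  subst h
  omega

/-- The place of a Kolyvagin prime lies above no unipotent-admissible prime. [folklore] -/
theorem not_mem_of_kolyvagin_place {q ℓ : ℕ} (hq : IsUAdmissiblePrime W K q)
    (hℓ : Zhang2014.IsKolyvaginPrime (W.conductorNorm ℤ) W K 3 ℓ) (v : HeightOneSpectrum (𝓞 K))
    (hv : (ℓ : 𝓞 K) ∈ v.asIdeal) : (q : 𝓞 K) ∉ v.asIdeal :=
  not_mem_asIdeal_of_coprime K (coprime_of_uAdmissible_of_kolyvagin W K hq hℓ).symm v hv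

variable [W.IsElliptic] [NeZero (W.conductorNorm ℤ)]
  (Dt : ModularParametrizationData W (W.conductorNorm ℤ)) (β : ℤ) (ι : K →+* ℂ) (c : K ≃ₐ[ℚ] K)
  [Module (ZMod 3) (V3 W K)]

/-- **S2-ENGINE, DICTIONARY LAYER: from a `LevelKolyvaginSystem` to a non-zero Kolyvagin class over the places of `K`,
modulo the level-system-FREE local–global inputs.** Apparatus: local spaces `Hv v` at the places `v : Place K` with
`ZMod 3`-linear localisations `loc v` and bilinear forms `b v`; eigenspaces `E s` of complex conjugation (dictionary
`hE`); per-place conditions `Kum v` (E's Kummer condition: dictionaries `hKumInf`, `hKumFin`), `Ord v` (ordinary: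
`hOrd`), `Tr ℓ` (transverse at the place `plK ℓ` of the Kolyvagin prime `ℓ`: `hTr`), strict vanishing (`hZero`:
`torsionLocalKer_v = ker loc_v`); the level structure `L n` pinned by `hLinf` ∕ `hLkum` ∕ `hLord`; the places `plK` ∕
`plU` of the Kolyvagin ∕ unipotent-admissible primes (`hplK`, `hplU`). Level-system-free inputs kept as hypotheses:
(REC) `hrec`, isotropy `hisoL` ∕
`hisoT`, (Perf) `hperf`, (Line) `hline`, (Cheb) `hCheb1` ∕ `hCheb2`, (Supply) `hSupply`. DISCHARGED here from the system
`S` and the membership lemmas: `hSel`, `hSelRel`, `hB`, `hpl`, `hLF`, `hcE`, `hcL`, `hcT`, `hfs`, (A2), (A5), the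
witness. [cite: WZhang2014, §8.1, Lemma 8.4, §9 proof of Thm. 9.1] [cite: McCallumLMS1991, Prop. 3.1, Lemma 5.3] -/
theorem inductionOfLevelSystems_of_dictionaries (hK : IsImaginaryQuadratic K) (S : LevelKolyvaginSystem W K Dt β ι c)
    {Hv : Place K → Type} [∀ v, AddCommGroup (Hv v)] [∀ v, Module (ZMod 3) (Hv v)]
    (loc : (v : Place K) → V3 W K →ₗ[ZMod 3] Hv v) (b : (v : Place K) → Hv v →ₗ[ZMod 3] Hv v →ₗ[ZMod 3] ZMod 3)
    (E : Bool → Submodule (ZMod 3) (V3 W K))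
    (Kum : (v : Place K) → Submodule (ZMod 3) (Hv v))
    (Ord : (v : HeightOneSpectrum (𝓞 K)) → Submodule (ZMod 3) (Hv (Sum.inr v)))
    (plK : {ℓ // Zhang2014.IsKolyvaginPrime (W.conductorNorm ℤ) W K 3 ℓ} → HeightOneSpectrum (𝓞 K))
    (plU : {q // IsUAdmissiblePrime W K q} → HeightOneSpectrum (𝓞 K))
    (Tr : (ℓ : {ℓ // Zhang2014.IsKolyvaginPrime (W.conductorNorm ℤ) W K 3 ℓ}) →
      Submodule (ZMod 3) (Hv (Sum.inr (plK ℓ))))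
    (L : Finset {q // IsUAdmissiblePrime W K q} → (v : Place K) → Submodule (ZMod 3) (Hv v))
    -- the places of the Kolyvagin ∕ unipotent-admissible primes
    (hplK : ∀ ℓ, ((ℓ : ℕ) : 𝓞 K) ∈ (plK ℓ).asIdeal) (hplU : ∀ q, ((q : ℕ) : 𝓞 K) ∈ (plU q).asIdeal)
    -- per-place dictionaries with the tree's global currency
    (hE : ∀ (s : Bool) (x : V3 W K), x ∈ E s ↔ conjAct W c ((3 ^ 1 : ℕ) : ℤ) x = sgn s • x)
    (hKumInf : ∀ (w : InfinitePlace K) (x : V3 W K),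
      x ∈ selmerLocalKer (W.baseChange K) w.Completion ((3 ^ 1 : ℕ) : ℤ) ↔ loc (Sum.inl w) x ∈ Kum (Sum.inl w))
    (hKumFin : ∀ (v : HeightOneSpectrum (𝓞 K)) (x : V3 W K),
      x ∈ selmerLocalKer (W.baseChange K) (v.adicCompletion K) ((3 ^ 1 : ℕ) : ℤ) ↔ loc (Sum.inr v) x ∈ Kum (Sum.inr v))
    (hOrd : ∀ (v : HeightOneSpectrum (𝓞 K)) (x : V3 W K),
      x ∈ (W.baseChange K).ordinaryLocalKer (v.adicCompletion K) ((3 ^ 1 : ℕ) : ℤ) ↔ loc (Sum.inr v) x ∈ Ord v)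
    (hTr : ∀ (ℓ : {ℓ // Zhang2014.IsKolyvaginPrime (W.conductorNorm ℤ) W K 3 ℓ}) (x : V3 W K),
      x ∈ transverseLocalKer W K ι ℓ (plK ℓ) ↔ loc (Sum.inr (plK ℓ)) x ∈ Tr ℓ)
    (hZero : ∀ (v : HeightOneSpectrum (𝓞 K)) (x : V3 W K),
      x ∈ (W.baseChange K).torsionLocalKer (v.adicCompletion K) ((3 ^ 1 : ℕ) : ℤ) ↔ loc (Sum.inr v) x = 0)
    -- the level structure
    (hLinf : ∀ (n : Finset {q // IsUAdmissiblePrime W K q}) (w : InfinitePlace K), L n (Sum.inl w) = Kum (Sum.inl w))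
    (hLkum : ∀ (n : Finset {q // IsUAdmissiblePrime W K q}) (v : HeightOneSpectrum (𝓞 K)),
      (∀ q ∈ n, ((q : ℕ) : 𝓞 K) ∉ v.asIdeal) →
      L n (Sum.inr v) = Kum (Sum.inr v))
    (hLord : ∀ (n : Finset {q // IsUAdmissiblePrime W K q}) (v : HeightOneSpectrum (𝓞 K)), ∀ q ∈ n,
      ((q : ℕ) : 𝓞 K) ∈ v.asIdeal → L n (Sum.inr v) = Ord v)
    -- level-system-free local–global inputs
    (hisoL : ∀ (n : Finset {q // IsUAdmissiblePrime W K q}) (v : Place K), ∀ x ∈ L n v, ∀ y ∈ L n v, b v x y = 0)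
    (hisoT : ∀ (ℓ : {ℓ // Zhang2014.IsKolyvaginPrime (W.conductorNorm ℤ) W K 3 ℓ}), ∀ x ∈ Tr ℓ, ∀ y ∈ Tr ℓ,
      b (Sum.inr (plK ℓ)) x y = 0)
    (hperf : ∀ (ℓ : {ℓ // Zhang2014.IsKolyvaginPrime (W.conductorNorm ℤ) W K 3 ℓ}) (s : Bool), ∀ x ∈ E s, ∀ y ∈ E s,
      loc (Sum.inr (plK ℓ)) x ∈ Kum (Sum.inr (plK ℓ)) →
      loc (Sum.inr (plK ℓ)) x ≠ 0 → loc (Sum.inr (plK ℓ)) y ∈ Tr ℓ → loc (Sum.inr (plK ℓ)) y ≠ 0 →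
      b (Sum.inr (plK ℓ)) (loc (Sum.inr (plK ℓ)) x) (loc (Sum.inr (plK ℓ)) y) ≠ 0)
    (hline : ∀ (ℓ : {ℓ // Zhang2014.IsKolyvaginPrime (W.conductorNorm ℤ) W K 3 ℓ}) (s : Bool),
      ∃ e : Hv (Sum.inr (plK ℓ)), ∀ x ∈ E s,
      loc (Sum.inr (plK ℓ)) x ∈ Kum (Sum.inr (plK ℓ)) → ∃ a : ZMod 3, loc (Sum.inr (plK ℓ)) x = a • e)
    (hrec : ∀ (x y : V3 W K) (T : Finset (Place K)), (∀ v, v ∉ T → b v (loc v x) (loc v y) = 0) →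
      ∑ v ∈ T, b v (loc v x) (loc v y) = 0)
    (hCheb1 : ∀ x : V3 W K, x ≠ 0 → ∀ T : Finset {ℓ // Zhang2014.IsKolyvaginPrime (W.conductorNorm ℤ) W K 3 ℓ},
      ∃ ℓ, ℓ ∉ T ∧ loc (Sum.inr (plK ℓ)) x ≠ 0)
    (hCheb2 : ∀ (s : Bool), ∀ x ∈ E s, ∀ y ∈ E (!s), x ≠ 0 → y ≠ 0 →
      ∀ T : Finset {ℓ // Zhang2014.IsKolyvaginPrime (W.conductorNorm ℤ) W K 3 ℓ},
      ∃ ℓ, ℓ ∉ T ∧ loc (Sum.inr (plK ℓ)) x ≠ 0 ∧ loc (Sum.inr (plK ℓ)) y ≠ 0)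
    (hSupply : ∀ n, GoodLevel W K n → n.Nonempty →
      ∀ (ℓ : {ℓ // Zhang2014.IsKolyvaginPrime (W.conductorNorm ℤ) W K 3 ℓ}) (T : Finset _), ℓ ∉ T →
      ∀ s : Bool, ∃ x ∈ E s, x ≠ 0 ∧
        (∀ v : Place K, v ≠ Sum.inr (plK ℓ) → (∀ ℓ' ∈ T, Sum.inr (plK ℓ') ≠ v) → loc v x ∈ L n v) ∧
        ∀ ℓ' ∈ T, loc (Sum.inr (plK ℓ')) x ∈ Tr ℓ')
    -- (A1) at the frame, the parity and the rank ≥ 3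
    (hA1 : ∀ (n : Finset {q // IsUAdmissiblePrime W K q}) (μ : Bool) (x : V3 W K),
      GoodLevel W K n → x ∈ SelQ W K c n μ → x ≠ 0 →
      ∃ q : {q // IsUAdmissiblePrime W K q}, q ∉ n ∧ GoodLevel W K (insert q n) ∧
        x ∉ SelQ W K c (insert q n) μ ∧
        SelQ W K c (insert q n) μ ≤ SelQ W K c n μ ∧
        finrank (ZMod 3) (SelQ W K c (insert q n) μ) + 1 = finrank (ZMod 3) (SelQ W K c n μ) ∧
        SelQ W K c (insert q n) (!μ) = SelQ W K c n (!μ))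
    (hodd : Odd (finrank (ZMod 3)
      (AddSubgroup.toZModSubmodule 3 (selmerGroup (W.baseChange K) ((3 ^ 1 : ℕ) : ℤ)))))
    (h3 : 3 ≤ finrank (ZMod 3)
      (AddSubgroup.toZModSubmodule 3 (selmerGroup (W.baseChange K) ((3 ^ 1 : ℕ) : ℤ)))) :
    ∃ (n : ℕ) (d : KolyvaginHeegnerData Dt β ι n),
      KolyvaginDescent.KolSupp (Zhang2014.IsKolyvaginPrime (W.conductorNorm ℤ) W K 3) n ∧
        d.kolyvaginClass Nat.prime_three 1 ≠ 0 := by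
  -- uniqueness of the places above the inert primes (a non-zero prime of a Dedekind domain is maximal)
  have huniq : ∀ {q : ℕ}, (Ideal.span {(q : 𝓞 K)}).IsPrime → q ≠ 0 → ∀ {v v' : HeightOneSpectrum (𝓞 K)},
      (q : 𝓞 K) ∈ v.asIdeal → (q : 𝓞 K) ∈ v'.asIdeal → v' = v := by
    intro q hq hq0 v v' hv hv'
    have key : ∀ w : HeightOneSpectrum (𝓞 K), (q : 𝓞 K) ∈ w.asIdeal → w.asIdeal = Ideal.span {(q : 𝓞 K)} := by
      intro w hw
      have hle : Ideal.span {(q : 𝓞 K)} ≤ w.asIdeal := by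
        rw [Ideal.span_le, Set.singleton_subset_iff]
        exact hw
      have hne : Ideal.span {(q : 𝓞 K)} ≠ ⊥ := by
        rw [Ne, Ideal.span_singleton_eq_bot]
        exact_mod_cast hq0
      exact ((hq.isMaximal hne).eq_of_le w.isPrime.ne_top hle).symm
    exact HeightOneSpectrum.ext (by rw [key v hv, key v' hv'])
  have hKuniq : ∀ (ℓ : {ℓ // Zhang2014.IsKolyvaginPrime (W.conductorNorm ℤ) W K 3 ℓ}) (v : HeightOneSpectrum (𝓞 K)),
      ((ℓ : ℕ) : 𝓞 K) ∈ v.asIdeal → v = plK ℓ :=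
    fun ℓ v hv ↦
    huniq ℓ.2.2.2.2.2.1 ℓ.2.1.ne_zero (hplK ℓ) hv
  have hUuniq : ∀ (q : {q // IsUAdmissiblePrime W K q}) (v : HeightOneSpectrum (𝓞 K)),
      ((q : ℕ) : 𝓞 K) ∈ v.asIdeal → v = plU q :=
    fun q v hv ↦
    huniq q.2.2.2.2.2.1 q.2.1.ne_zero (hplU q) hv
  -- membership dictionary for the canonical spaces
  have hSel : ∀ n, GoodLevel W K n → ∀ (s : Bool) (x : V3 W K),
      x ∈ SelQ W K c n s ↔ x ∈ E s ∧ ∀ v, loc v x ∈ L n v := by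
    intro n _ s x
    rw [mem_selQ_iff, hE]
    refine and_congr_right fun _ ↦ ⟨fun ⟨hinf, hfin, hord⟩ v ↦ ?_, fun h ↦ ⟨fun w ↦ ?_, fun v hv ↦ ?_,
      fun q hq v hv ↦ ?_⟩⟩
    · rcases v with w | v
      · rw [hLinf]; exact (hKumInf w x).mp (hinf w)
      · by_cases hv : ∃ q ∈ n, ((q : ℕ) : 𝓞 K) ∈ v.asIdeal
        · obtain ⟨q, hq, hqv⟩ := hv
          rw [hLord n v q hq hqv]; exact (hOrd v x).mp (hord q hq v hqv)
        · push Not at hv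
          rw [hLkum n v hv]; exact (hKumFin v x).mp (hfin v hv)
    · have := h (Sum.inl w); rw [hLinf] at this; exact (hKumInf w x).mpr this
    · have := h (Sum.inr v); rw [hLkum n v hv] at this; exact (hKumFin v x).mpr this
    · have := h (Sum.inr v); rw [hLord n v q hq hv] at this; exact (hOrd v x).mpr this
  -- membership dictionary for the spaces relaxed at the base locus
  have hSelRel : ∀ n, GoodLevel W K n → ∀ (s : Bool) (x : V3 W K),
      x ∈ SelRelQ W K c n (baseLocusQ W K S.κ n) s ↔
        x ∈ E s ∧ ∀ v, v ∉ (fun q ↦ (Sum.inr (plU q) : Place K)) '' baseLocusQ W K S.κ n → loc v x ∈ L n v := by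
    intro n _ s x
    rw [mem_selRelQ_iff, hE]
    refine and_congr_right fun _ ↦ ⟨fun ⟨hinf, hfin, hord⟩ v hvB ↦ ?_, fun h ↦ ⟨fun w ↦ ?_, fun v hv hvS ↦ ?_,
      fun q hq hqS v hv ↦ ?_⟩⟩
    · rcases v with w | v
      · rw [hLinf]; exact (hKumInf w x).mp (hinf w)
      · by_cases hv : ∃ q ∈ n, ((q : ℕ) : 𝓞 K) ∈ v.asIdeal
        · obtain ⟨q, hq, hqv⟩ := hv
          have hqS : q ∉ baseLocusQ W K S.κ n := fun h ↦ hvB ⟨q, h, by rw [hUuniq q v hqv]⟩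
          rw [hLord n v q hq hqv]; exact (hOrd v x).mp (hord q hq hqS v hqv)
        · push Not at hv
          have hvS : ∀ q ∈ baseLocusQ W K S.κ n, ((q : ℕ) : 𝓞 K) ∉ v.asIdeal :=
            fun q hq hqv ↦ hvB ⟨q, hq, by rw [hUuniq q v hqv]⟩
          rw [hLkum n v hv]; exact (hKumFin v x).mp (hfin v hv hvS)
    · have := h (Sum.inl w) (by rintro ⟨q, -, hq⟩; exact Sum.inr_ne_inl hq)
      rw [hLinf] at this; exact (hKumInf w x).mpr this
    · have := h (Sum.inr v) (by
        rintro ⟨q, hq, hqv⟩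
        exact hvS q hq ((Sum.inr_injective hqv) ▸ hplU q))
      rw [hLkum n v hv] at this; exact (hKumFin v x).mpr this
    · have := h (Sum.inr v) (by
        rintro ⟨q', hq', hq'v⟩
        have hvq' : v = plU q' := (Sum.inr_injective hq'v).symm
        have hqq' : q = q' := by
          by_contra hne
          have hcop : Nat.Coprime (q' : ℕ) (q : ℕ) := (Nat.coprime_primes q'.2.1 q.2.1).mpr
            (fun h ↦ hne (Subtype.ext h.symm))
          exact not_mem_asIdeal_of_coprime K hcop v (hvq' ▸ hplU q') hv
        exact hqS (hqq' ▸ hq'))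
      rw [hLord n v q hq hv] at this; exact (hOrd v x).mpr this
  -- the classes vanish on the base locus
  have hB : ∀ n, ∀ q ∈ baseLocusQ W K S.κ n, ∀ m, loc (Sum.inr (plU q)) (S.κ m n) = 0 :=
    fun n q hq m ↦ (hZero (plU q) _).mp (hq m (plU q) (hplU q))
  -- the Kolyvagin places are pairwise distinct and carry the Kummer condition at every level
  have hpl : Function.Injective (fun ℓ ↦ (Sum.inr (plK ℓ) : Place K)) := by
    intro ℓ ℓ' h
    have h' : plK ℓ = plK ℓ' := Sum.inr_injective h
    by_contra hne
    have hcop : Nat.Coprime (ℓ : ℕ) (ℓ' : ℕ) := (Nat.coprime_primes ℓ.2.1 ℓ'.2.1).mpr (fun h ↦ hne (Subtype.ext h))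
    exact not_mem_asIdeal_of_coprime K hcop (plK ℓ) (hplK ℓ) (h' ▸ hplK ℓ')
  have hLF : ∀ n ℓ, L n (Sum.inr (plK ℓ)) = Kum (Sum.inr (plK ℓ)) := fun n ℓ ↦
    hLkum n (plK ℓ) fun q _ ↦ not_mem_of_kolyvagin_place W K q.2 ℓ.2 (plK ℓ) (hplK ℓ)
  -- the Kolyvagin-system readings of the classes
  have hcE : ∀ n, GoodLevel W K n → n.Nonempty → ∀ m, S.κ m n ∈ E (S.ε₀ n ^^ Nat.bodd m.card) :=
    fun n hg hn m ↦ (hE _ _).mpr (S.sign n hg hn m)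
  have hcL : ∀ n, GoodLevel W K n → n.Nonempty → ∀ m (v : Place K),
      (∀ ℓ ∈ m, (Sum.inr (plK ℓ) : Place K) ≠ v) → loc v (S.κ m n) ∈ L n v := by
    intro n hg hn m v hv
    rcases v with w | v
    · rw [hLinf]; exact (hKumInf w _).mp (S.selmer_inf n hg hn m w)
    · by_cases hvn : ∃ q ∈ n, ((q : ℕ) : 𝓞 K) ∈ v.asIdeal
      · obtain ⟨q, hq, hqv⟩ := hvn
        rw [hLord n v q hq hqv]; exact (hOrd v _).mp (S.ordinary_on n hg hn m q hq v hqv)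
      · push Not at hvn
        have hvm : ∀ ℓ ∈ m, ((ℓ : ℕ) : 𝓞 K) ∉ v.asIdeal := fun ℓ hℓ hℓv ↦ hv ℓ hℓ (by rw [hKuniq ℓ v hℓv])
        rw [hLkum n v hvn]; exact (hKumFin v _).mp (S.selmer_off n hg hn m v hvm hvn)
  have hcT : ∀ n, GoodLevel W K n → n.Nonempty → ∀ m, ∀ ℓ ∈ m, loc (Sum.inr (plK ℓ)) (S.κ m n) ∈ Tr ℓ :=
    fun n hg hn m ℓ hℓ ↦ (hTr ℓ _).mp (S.transverse_on n hg hn m ℓ hℓ (plK ℓ) (hplK ℓ))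
  have hfs : ∀ n, GoodLevel W K n → n.Nonempty → ∀ m ℓ, ℓ ∉ m →
      (loc (Sum.inr (plK ℓ)) (S.κ (insert ℓ m) n) = 0 ↔ loc (Sum.inr (plK ℓ)) (S.κ m n) = 0) := by
    intro n hg hn m ℓ hℓ
    rw [← hZero, ← hZero]
    exact S.relation n hg hn m ℓ hℓ (plK ℓ) (hplK ℓ)
  exact inductionOfLevelSystems_of_engineInputs W K Dt β ι c hK S E loc b L (fun ℓ ↦ Sum.inr (plK ℓ))
    (fun q ↦ Sum.inr (plU q)) (fun ℓ ↦ Kum (Sum.inr (plK ℓ))) Tr hSel hSelRel hB hpl hLF hisoL hisoT hperf hline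
    hrec hcE hcL hcT hfs hCheb1 hCheb2 hSupply hA1 hodd h3

end Summit.BirchSwinnertonDyer.Rank1Residual.X11b.Three.Koly.Method2

end
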